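import Summits.BirchSwinnertonDyer.Rank1Residual.X5.TwoAdicInstancesMultAnchorsS
import Summits.BirchSwinnertonDyer.Rank1Residual.X5.TwoAdicInstances144027d
import Summits.BirchSwinnertonDyer.Rank1Residual.X5.TwoAdicInstancesToolkitC
import Summits.BirchSwinnertonDyer.Rank1Residual.X5.TwoAdicInstancesToolkitD
import HarnessLib

/-!
# X5 at `p = 2` (cell `bsd-2adic`, seat `bsd-2adic-t42`, GEN 7): SPLIT ANCHORS `330c4`, `1590j2` for DOOR (34-GV-mult) — curve data only

HONEST FRAMING (cell `bsd-2adic`, run/shared/lean/pub/bsd-2adic/, HUMAN RULINGS D-0036 / D-0054): research route; NO door theorem,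
nothing displayed, nothing booked; BSD is not proved by any of this. PARTITION: X5@2 multiplicative (K4ᵐ, RESIDUAL-MAP B1·O1;
tranche 1 of the GV-mult habitat) × p = 2 — types-the-object-of (anchor curves for the congruence transport; closes none).
WHAT: the split multiplicative ANCHORS (`2 ∥ N`, `r = 0`, exactly one rational `2`-torsion point, of Greenberg type A or B) that the
tranche-1 classes of HOME/t42/DESIGN-T42-ADDENDUM-8.md need and that are NOT in the mult lane's anchors files
`X5/TwoAdicInstancesMultAnchors{A,B,C,S}.lean` (one writer per object: those files are imported elsewhere, never edited; planner word
2026-08-27T03:25:10Z (A) «if a class needs a NEW anchor, add it in a t42 anchors file»). Per anchor, DECIDED BY THE KERNEL: minimality,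
ellipticity, SPLIT multiplicative reduction at `2`, the conductor (squarefree: coprimality; additive `3`: Rizzo's Table II in the kernel;
additive `ℓ ≥ 5`: `f = 2`), the unique rational `2`-torsion point and its Greenberg type, `2 ∣ #Ẽ(𝔽_ℓ)` at good odd `ℓ`. The anchors'
λ-invariant enters the doors ONLY through the displayed certificate binders `hlanA : λ_an(A) = 1`, `hμanA` of the class files (rows:
engine-1 kit j268238 (GVM-cert.gp @e1208179ed243b20 verbatim: LAW PASS, MU0 YES) + engine-2 kit j268244 (afe2_engine.gp v2 @9fa2375668e227f7: verdict OK, STABLE) — two-engine, t42 GEN 7) — EVIDENCE, never facts. Emitter: HOME/t42/gen/gen_anchorsfile.py + memberdata.py (port of the mult lane's genlaw5.py member block).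
WHAT THIS IS NOT: not a door, not a certificate, not a discharge of anything.

References: [SilvermanAEC2009] VII.1, VII.3.1, VII.5.1, III.1–III.2; [Silverman1994] IV.10.2; [GreenbergLNM1716] §5, Prop. 5.14;
[GreenbergVatsal2000] p. 4 (anchors); [CremonaAlgorithms1997] Table 1 (330c4, 1590j2); [Rizzo2003] Table II.
-/

set_option autoImplicit false

open IsDedekindDomain WeierstrassCurve Literature.NumberTheory.EllipticCurves
  Literature.NumberTheory.EllipticCurves.ModularForms
  Literature.NumberTheory.EllipticCurves.Rank1Residual
  Literature.NumberTheory.EllipticCurves.Rank1Residual.Typed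
  Literature.NumberTheory.EllipticCurves.Greenberg1999
  Literature.NumberTheory.EllipticCurves.PolyCert
  Literature.NumberTheory.EllipticCurves.Rank1Residual.X11RankOneCertificates
  Summit.BirchSwinnertonDyer.Rank1Residual.X1.MuPart
  Summit.BirchSwinnertonDyer.Rank1Residual.X1.ParitySqueeze
  Summit.BirchSwinnertonDyer.Rank1Residual.X5.O1

open CongruenceSubgroup
open scoped MatrixGroups ModularForm

namespace Summit.BirchSwinnertonDyer.Rank1Residual.X5.Instances

/-! ## Anchor `330c4` (`N = 330`, split at `2`, type A, `x(P) = 259/4`) -/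

/-- Cremona `330c4` = `[1, 1, 1, -11825, 488927]` (integer model). [cite: CremonaAlgorithms1997, Table 1] -/
abbrev M330c4 : WeierstrassCurve ℤ := ⟨1, 1, 1, -11825, 488927⟩
/-- `330c4 / ℚ`. [cite: CremonaAlgorithms1997, Table 1] -/
abbrev c330c4 : WeierstrassCurve ℚ := M330c4.baseChange ℚ
/-- `Δ(330c4) = 2^4·3^3·5·11^8`. [cite: CremonaAlgorithms1997, Table 1] -/
theorem M330c4_Δ : M330c4.Δ = 463015182960 := by decide
/-- `c₄(330c4)` (`|c₄| = 567601`). [cite: CremonaAlgorithms1997, Table 1] -/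
theorem M330c4_c₄ : M330c4.c₄ = 567601 := by decide
/-- `330c4` is an elliptic curve. [cite: CremonaAlgorithms1997, Table 1] -/
instance c330c4_isElliptic : c330c4.IsElliptic := by
  rw [WeierstrassCurve.isElliptic_iff, baseChange_int_Δ, M330c4_Δ]; norm_num
/-- Cremona's model `330c4` is globally minimal (`gcd(Δ, c₄) = 1`). [cite: SilvermanAEC2009, VII.1 Remark 1.1] -/
instance c330c4_isGloballyMinimal : c330c4.IsGloballyMinimal :=
  isGloballyMinimal_baseChange_int_of_gcd_eq_one 1 1 1 (-11825) 488927 (by decide)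
/-- **`330c4` is multiplicative at `2`** (`2 ∣ Δ`, `2 ∤ c₄`). [cite: SilvermanAEC2009, VII.5 Prop. 5.1(b)] -/
theorem mult_two_330c4 : Mult c330c4 2 := by
  have hgen : Rat.HeightOneSpectrum.natGenerator
      ((Rat.HeightOneSpectrum.primesEquiv (R := ℤ)).symm ⟨2, Nat.prime_two⟩) = 2 :=
    Literature.NumberTheory.EllipticCurves.Rat.natGenerator_primesEquiv_symm ⟨2, Nat.prime_two⟩
  have hm : c330c4.HasMultiplicativeReductionAt
      ((Rat.HeightOneSpectrum.primesEquiv (R := ℤ)).symm ⟨2, Nat.prime_two⟩) := by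
    refine hasMultiplicativeReductionAt_of_valuation_c₄_eq_one (isIntegralAt_baseChange _ M330c4) ?_ ?_
    · rw [baseChange_int_c₄, Literature.NumberTheory.EllipticCurves.Rat.valuation_intCast_eq_one_iff, hgen,
        M330c4_c₄]; decide
    · rw [baseChange_int_Δ, Literature.NumberTheory.EllipticCurves.Rat.valuation_intCast_lt_one_iff, hgen,
        M330c4_Δ]; decide
  exact (hasMultiplicativeReductionAtPrime_iff_hasMultiplicativeReductionAt_holds c330c4
    ⟨2, Nat.prime_two⟩).mpr hm
/-- `330c4 mod 2`. [folklore] -/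
theorem M330c4_mod_two : M330c4.map (Int.castRingHom (ZMod 2)) = ⟨1, 1, 1, 1, 1⟩ := by
  ext <;> decide
/-- **`330c4` is SPLIT multiplicative at `2`** (the node quadratic has the root `0` in `𝔽₂`). [cite: SilvermanAEC2009, VII.5 Prop. 5.1(b)] -/
theorem split_two_330c4 : c330c4.HasSplitMultiplicativeReductionAtPrime 2 := by
  have hint : integralModelInt c330c4 = M330c4 := integralModelInt_baseChange_int M330c4
  have hΔ : ((2 : ℕ) : ℤ) ∣ (integralModelInt c330c4).Δ := by rw [hint, M330c4_Δ]; decide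
  have hc₄ : ¬ ((2 : ℕ) : ℤ) ∣ (integralModelInt c330c4).c₄ := by rw [hint, M330c4_c₄]; decide
  rw [LocalTorsionMult.hasSplitMultiplicativeReductionAtPrime_iff_splits_integralModelInt c330c4 2 hΔ
    hc₄, hint, M330c4_mod_two]
  dsimp only
  rw [sub_eq_add_neg, ← Polynomial.C_neg]
  exact splits_quadratic_F2_of_root (by decide) 0 (by decide)
/-- `Δ(330c4)`, `c₄(330c4)` coprime (semistable model). [cite: SilvermanAEC2009, VII.5 Prop. 5.1(b)] -/
theorem M330c4_coprime : IsCoprime M330c4.Δ M330c4.c₄ := by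
  rw [M330c4_Δ, M330c4_c₄, Int.isCoprime_iff_gcd_eq_one]; decide
/-- **The conductor of `330c4` is `330`** (semistable: the radical of `Δ`; Silverman ATAEC IV.10.2). [cite: CremonaAlgorithms1997, Table 1] [cite: Silverman1994, IV.10.2] -/
theorem conductorNorm_330c4 : c330c4.conductorNorm ℤ = 330 := by
  refine conductorNorm_baseChange_int_of_isCoprime M330c4 M330c4_coprime (k := 8) ?_ ?_ ?_
  · rw [Nat.squarefree_iff_nodup_primeFactorsList (by norm_num)]; simp
  · rw [M330c4_Δ]; decide
  · rw [M330c4_Δ]; decide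

/-- The coefficients of `330c4 / ℚ` (unfolded). [cite: CremonaAlgorithms1997, Table 1] -/
theorem c330c4_eq : c330c4 = ⟨1, 1, 1, -11825, 488927⟩ := by
  rw [c330c4, baseChange_int_eq]; norm_num
/-- `b₂, b₄, b₆` of `330c4`; `2`-division cubic `= (x − (259 / 4))(4x² + (264)x + ((-30204)))`. [cite: SilvermanAEC2009, III.1] -/
theorem c330c4_b : c330c4.b₂ = 5 ∧ c330c4.b₄ = -23649 ∧ c330c4.b₆ = 1955709 := by
  rw [c330c4_eq]
  simp only [WeierstrassCurve.b₂, WeierstrassCurve.b₄, WeierstrassCurve.b₆]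
  norm_num
/-- The rational point `(259/4, -263/8)` of order `2` on `330c4`. [cite: CremonaAlgorithms1997, Table 1] -/
theorem c330c4_P : c330c4.toAffine.Equation (259 / 4) (-263 / 8) ∧
    2 * ((-263 / 8) : ℚ) + c330c4.a₁ * (259 / 4) + c330c4.a₃ = 0 := by
  rw [c330c4_eq, WeierstrassCurve.Affine.equation_iff]; norm_num
/-- **`(259/4, -263/8)` is the ONLY rational point of order `2` on `330c4`** (the cofactor `4x² + (264)x + ((-30204))` has non-square discriminant). [cite: SilvermanAEC2009, III.2.3] -/
theorem c330c4_unique : HasUniqueRationalTwoTorsionX c330c4 (259 / 4) := by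
  refine ⟨⟨(-263 / 8), c330c4_P⟩, fun z hz ↦ ?_⟩
  have hc := cubic_eq_zero_of_hasRationalTwoTorsionX hz
  obtain ⟨hb₂, hb₄, hb₆⟩ := c330c4_b
  rw [hb₂, hb₄, hb₆] at hc
  have hfac : (z - (259 / 4)) * (4 * z ^ 2 + 264 * z + (-30204)) = 0 := by linear_combination hc
  exact eq_of_cubic_factor_of_not_isSquare z hfac (by norm_num)
/-- `(259/4, ·)` is "ramified at `2`" (`v₂(x) = −2`). [cite: GreenbergLNM1716, §5 (chunk p0176)] -/
theorem c330c4_ram : TwoTorsionRamifiedAtTwo ((259 / 4) : ℚ) := by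
  have := twoTorsionRamifiedAtTwo_of_odd_div_four (259) (by decide)
  push_cast at this
  simpa [neg_div] using this
/-- `(259/4, ·)` is NOT "odd": `(−u − √(u² − 16v))/8 < 259/4` is a smaller real root of the `2`-division cubic (`u = 264`, `v = -30204`).
[cite: GreenbergLNM1716, §5 Remark (chunk p0174)] -/
theorem c330c4_not_odd : ¬ TwoTorsionOdd c330c4 (259 / 4) := by
  intro hodd
  obtain ⟨hb₂, hb₄, hb₆⟩ := c330c4_b
  obtain ⟨r, hr, hlt⟩ := exists_cubic_root_lt (x₀ := ((259 / 4) : ℝ)) (u := 264) (v := (-30204)) (by norm_num)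
    (lt_of_lt_of_le (by norm_num) (Real.sqrt_nonneg _))
  have := hodd r (by rw [hb₂, hb₄, hb₆]; push_cast; linear_combination hr)
  push_cast at this
  linarith
/-- **`(259/4, ·)` is of Greenberg type A** (ramified at `2`, not odd). [cite: GreenbergLNM1716, Prop. 5.14 (p. 171)] -/
theorem c330c4_typeAB : (TwoTorsionRamifiedAtTwo ((259 / 4) : ℚ) ∧ ¬ TwoTorsionOdd c330c4 (259 / 4)) ∨
    (TwoTorsionOdd c330c4 (259 / 4) ∧ ¬ TwoTorsionRamifiedAtTwo ((259 / 4) : ℚ)) :=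
  Or.inl ⟨c330c4_ram, c330c4_not_odd⟩

/-- `2 ∣ #Ẽ(𝔽_ℓ)` for `330c4` at every good odd prime `ℓ` (a rational `2`-torsion point). [cite: SilvermanAEC2009, VII.3.1(b)] -/
theorem two_dvd_reductionPointCount_330c4 {ℓ : ℕ} [Fact ℓ.Prime] (hℓ : 3 ≤ ℓ)
    (hΔ : ¬ (ℓ : ℤ) ∣ (463015182960 : ℤ)) : 2 ∣ c330c4.reductionPointCount ℓ :=
  two_dvd_reductionPointCount_of_hasRationalTwoTorsionX ⟨(-263 / 8), c330c4_P⟩ hℓ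
    (by rw [minimalDiscriminantInt_baseChange_int, M330c4_Δ]; exact hΔ)

/-! ## Anchor `1590j2` (`N = 1590`, split at `2`, type A, `x(P) = -109/4`) -/

/-- Cremona `1590j2` = `[1, 1, 1, -2236, -41611]` (integer model). [cite: CremonaAlgorithms1997, Table 1] -/
abbrev M1590j2 : WeierstrassCurve ℤ := ⟨1, 1, 1, -2236, -41611⟩
/-- `1590j2 / ℚ`. [cite: CremonaAlgorithms1997, Table 1] -/
abbrev c1590j2 : WeierstrassCurve ℚ := M1590j2.baseChange ℚ
/-- `Δ(1590j2) = 2^3·3^10·5^2·53`. [cite: CremonaAlgorithms1997, Table 1] -/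
theorem M1590j2_Δ : M1590j2.Δ = 625919400 := by decide
/-- `c₄(1590j2)` (`|c₄| = 29·3701`). [cite: CremonaAlgorithms1997, Table 1] -/
theorem M1590j2_c₄ : M1590j2.c₄ = 107329 := by decide
/-- `1590j2` is an elliptic curve. [cite: CremonaAlgorithms1997, Table 1] -/
instance c1590j2_isElliptic : c1590j2.IsElliptic := by
  rw [WeierstrassCurve.isElliptic_iff, baseChange_int_Δ, M1590j2_Δ]; norm_num
/-- Cremona's model `1590j2` is globally minimal (`gcd(Δ, c₄) = 1`). [cite: SilvermanAEC2009, VII.1 Remark 1.1] -/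
instance c1590j2_isGloballyMinimal : c1590j2.IsGloballyMinimal :=
  isGloballyMinimal_baseChange_int_of_gcd_eq_one 1 1 1 (-2236) (-41611) (by decide)
/-- **`1590j2` is multiplicative at `2`** (`2 ∣ Δ`, `2 ∤ c₄`). [cite: SilvermanAEC2009, VII.5 Prop. 5.1(b)] -/
theorem mult_two_1590j2 : Mult c1590j2 2 := by
  have hgen : Rat.HeightOneSpectrum.natGenerator
      ((Rat.HeightOneSpectrum.primesEquiv (R := ℤ)).symm ⟨2, Nat.prime_two⟩) = 2 :=
    Literature.NumberTheory.EllipticCurves.Rat.natGenerator_primesEquiv_symm ⟨2, Nat.prime_two⟩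
  have hm : c1590j2.HasMultiplicativeReductionAt
      ((Rat.HeightOneSpectrum.primesEquiv (R := ℤ)).symm ⟨2, Nat.prime_two⟩) := by
    refine hasMultiplicativeReductionAt_of_valuation_c₄_eq_one (isIntegralAt_baseChange _ M1590j2) ?_ ?_
    · rw [baseChange_int_c₄, Literature.NumberTheory.EllipticCurves.Rat.valuation_intCast_eq_one_iff, hgen,
        M1590j2_c₄]; decide
    · rw [baseChange_int_Δ, Literature.NumberTheory.EllipticCurves.Rat.valuation_intCast_lt_one_iff, hgen,
        M1590j2_Δ]; decide
  exact (hasMultiplicativeReductionAtPrime_iff_hasMultiplicativeReductionAt_holds c1590j2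
    ⟨2, Nat.prime_two⟩).mpr hm
/-- `1590j2 mod 2`. [folklore] -/
theorem M1590j2_mod_two : M1590j2.map (Int.castRingHom (ZMod 2)) = ⟨1, 1, 1, 0, 1⟩ := by
  ext <;> decide
/-- **`1590j2` is SPLIT multiplicative at `2`** (the node quadratic has the root `0` in `𝔽₂`). [cite: SilvermanAEC2009, VII.5 Prop. 5.1(b)] -/
theorem split_two_1590j2 : c1590j2.HasSplitMultiplicativeReductionAtPrime 2 := by
  have hint : integralModelInt c1590j2 = M1590j2 := integralModelInt_baseChange_int M1590j2
  have hΔ : ((2 : ℕ) : ℤ) ∣ (integralModelInt c1590j2).Δ := by rw [hint, M1590j2_Δ]; decide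
  have hc₄ : ¬ ((2 : ℕ) : ℤ) ∣ (integralModelInt c1590j2).c₄ := by rw [hint, M1590j2_c₄]; decide
  rw [LocalTorsionMult.hasSplitMultiplicativeReductionAtPrime_iff_splits_integralModelInt c1590j2 2 hΔ
    hc₄, hint, M1590j2_mod_two]
  dsimp only
  rw [sub_eq_add_neg, ← Polynomial.C_neg]
  exact splits_quadratic_F2_of_root (by decide) 0 (by decide)
/-- `Δ(1590j2)`, `c₄(1590j2)` coprime (semistable model). [cite: SilvermanAEC2009, VII.5 Prop. 5.1(b)] -/
theorem M1590j2_coprime : IsCoprime M1590j2.Δ M1590j2.c₄ := by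
  rw [M1590j2_Δ, M1590j2_c₄, Int.isCoprime_iff_gcd_eq_one]; decide
/-- **The conductor of `1590j2` is `1590`** (semistable: the radical of `Δ`; Silverman ATAEC IV.10.2). [cite: CremonaAlgorithms1997, Table 1] [cite: Silverman1994, IV.10.2] -/
theorem conductorNorm_1590j2 : c1590j2.conductorNorm ℤ = 1590 := by
  refine conductorNorm_baseChange_int_of_isCoprime M1590j2 M1590j2_coprime (k := 10) ?_ ?_ ?_
  · rw [Nat.squarefree_iff_nodup_primeFactorsList (by norm_num)]; simp
  · rw [M1590j2_Δ]; decide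
  · rw [M1590j2_Δ]; decide

/-- The coefficients of `1590j2 / ℚ` (unfolded). [cite: CremonaAlgorithms1997, Table 1] -/
theorem c1590j2_eq : c1590j2 = ⟨1, 1, 1, -2236, -41611⟩ := by
  rw [c1590j2, baseChange_int_eq]; norm_num
/-- `b₂, b₄, b₆` of `1590j2`; `2`-division cubic `= (x − (-109 / 4))(4x² + ((-104))x + ((-6108)))`. [cite: SilvermanAEC2009, III.1] -/
theorem c1590j2_b : c1590j2.b₂ = 5 ∧ c1590j2.b₄ = -4471 ∧ c1590j2.b₆ = -166443 := by
  rw [c1590j2_eq]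
  simp only [WeierstrassCurve.b₂, WeierstrassCurve.b₄, WeierstrassCurve.b₆]
  norm_num
/-- The rational point `(-109/4, 105/8)` of order `2` on `1590j2`. [cite: CremonaAlgorithms1997, Table 1] -/
theorem c1590j2_P : c1590j2.toAffine.Equation (-109 / 4) (105 / 8) ∧
    2 * ((105 / 8) : ℚ) + c1590j2.a₁ * (-109 / 4) + c1590j2.a₃ = 0 := by
  rw [c1590j2_eq, WeierstrassCurve.Affine.equation_iff]; norm_num
/-- **`(-109/4, 105/8)` is the ONLY rational point of order `2` on `1590j2`** (the cofactor `4x² + ((-104))x + ((-6108))` has non-square discriminant). [cite: SilvermanAEC2009, III.2.3] -/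
theorem c1590j2_unique : HasUniqueRationalTwoTorsionX c1590j2 (-109 / 4) := by
  refine ⟨⟨(105 / 8), c1590j2_P⟩, fun z hz ↦ ?_⟩
  have hc := cubic_eq_zero_of_hasRationalTwoTorsionX hz
  obtain ⟨hb₂, hb₄, hb₆⟩ := c1590j2_b
  rw [hb₂, hb₄, hb₆] at hc
  have hfac : (z - (-109 / 4)) * (4 * z ^ 2 + (-104) * z + (-6108)) = 0 := by linear_combination hc
  exact eq_of_cubic_factor_of_not_isSquare z hfac (by norm_num)
/-- `(-109/4, ·)` is "ramified at `2`" (`v₂(x) = −2`). [cite: GreenbergLNM1716, §5 (chunk p0176)] -/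
theorem c1590j2_ram : TwoTorsionRamifiedAtTwo ((-109 / 4) : ℚ) := by
  have := twoTorsionRamifiedAtTwo_of_odd_div_four (-109) (by decide)
  push_cast at this
  simpa [neg_div] using this
/-- `(-109/4, ·)` is NOT "odd": `(−u − √(u² − 16v))/8 < -109/4` is a smaller real root of the `2`-division cubic (`u = -104`, `v = -6108`).
[cite: GreenbergLNM1716, §5 Remark (chunk p0174)] -/
theorem c1590j2_not_odd : ¬ TwoTorsionOdd c1590j2 (-109 / 4) := by
  intro hodd
  obtain ⟨hb₂, hb₄, hb₆⟩ := c1590j2_b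
  obtain ⟨r, hr, hlt⟩ := exists_cubic_root_lt (x₀ := ((-109 / 4) : ℝ)) (u := (-104)) (v := (-6108)) (by norm_num)
    ((Real.lt_sqrt (by norm_num)).mpr (by norm_num))
  have := hodd r (by rw [hb₂, hb₄, hb₆]; push_cast; linear_combination hr)
  push_cast at this
  linarith
/-- **`(-109/4, ·)` is of Greenberg type A** (ramified at `2`, not odd). [cite: GreenbergLNM1716, Prop. 5.14 (p. 171)] -/
theorem c1590j2_typeAB : (TwoTorsionRamifiedAtTwo ((-109 / 4) : ℚ) ∧ ¬ TwoTorsionOdd c1590j2 (-109 / 4)) ∨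
    (TwoTorsionOdd c1590j2 (-109 / 4) ∧ ¬ TwoTorsionRamifiedAtTwo ((-109 / 4) : ℚ)) :=
  Or.inl ⟨c1590j2_ram, c1590j2_not_odd⟩

/-- `2 ∣ #Ẽ(𝔽_ℓ)` for `1590j2` at every good odd prime `ℓ` (a rational `2`-torsion point). [cite: SilvermanAEC2009, VII.3.1(b)] -/
theorem two_dvd_reductionPointCount_1590j2 {ℓ : ℕ} [Fact ℓ.Prime] (hℓ : 3 ≤ ℓ)
    (hΔ : ¬ (ℓ : ℤ) ∣ (625919400 : ℤ)) : 2 ∣ c1590j2.reductionPointCount ℓ :=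
  two_dvd_reductionPointCount_of_hasRationalTwoTorsionX ⟨(105 / 8), c1590j2_P⟩ hℓ
    (by rw [minimalDiscriminantInt_baseChange_int, M1590j2_Δ]; exact hΔ)

end Summit.BirchSwinnertonDyer.Rank1Residual.X5.Instances
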